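/-
Copyright (c) 2026 the pub-hodgecm-mathlib formalisation cell (harness21).  Prover seat hodgecm-mathlib-K2E1-p08 (g2), Track B ∕ K2-LIT, h413 =
`stmt-HodgeConjecture-24833`, line `K2_E1_TraceFormulaBeta`; BY-NAME DEAL #11 (typed) of the dealer K2E1-plan (g2) 2026-09-04T00:07:54Z:
DEFS LEAF `Theorems/K2E1ResidualBlocksDefs.lean` — the residual isotypic blocks and the two named inputs (R-a) ∕ (R-b) of the block road to residual compactness.
-/
import Summits.HodgeConjecture.HodgeConjecture.Theorems.K2E1CuspidalSpectrumUnitaryDefsR     -- ★ p855423: `residualSubspace`, `ResidualSpectrumCompact`, `cmResidualSubspaceR`, `CmResidualSpectrumCompactR`, `cmParabolicDataR`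
import Summits.HodgeConjecture.HodgeConjecture.Theorems.K2E1SpectralTermsDiscreteHalf       -- ★ p855297: `DiscreteClass 𝒢 μ`, `DiscreteClass.out`, `mk`, `mult`
import Literature.NumberTheory.Automorphic.HilbertRepIsotypicComponent                      -- ★ `ContRepresentation.isotypicComponent`
import Literature.NumberTheory.Automorphic.HeckeEigenvectorProjection                       -- ★ `ClosedSubrep.inflate`
import Literature.NumberTheory.Rogawski1990.TestFunctions                                   -- ★ `UnitaryGroup.IsTestFunction`
import HarnessLib

/-!
# K2·E1 — DEFS LEAF `K2E1ResidualBlocksDefs`: the RESIDUAL ISOTYPIC BLOCKS `resBlock 𝒢 μ 𝔓 c` (`c` a discrete class) and the two NAMED INPUTS of the block road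
# (R-a) `ResidualBlocksCompact` («`R(f)` is compact on each block») ∕ (R-b) `ResidualBlocksDecay` («`‖R(f)|block c‖ → 0` cofinitely in `c`»), with their `U(Φ_N)` readings

Track B ∕ K2-LIT, crux h413 = `stmt-HodgeConjecture-24833`, route of record `HCCMUnconditional`; cell `hodgecm-mathlib`, squad K2, ENGINE E1 (socket module
`K2_E1_TraceFormulaBetaSigs_GlobalIndex`, live sockets `sig_K2E1ResidualCompactU2` ∕ `sig_K2E1ResidualCompactU3R` = ★ `CmResidualSpectrumCompactR L N μ`); prover seat
`hodgecm-mathlib-K2E1-p08` (g2), BY-NAME DEAL #11 (typed) of the dealer K2E1-plan (g2) 2026-09-04T00:07:54Z after the survey memo `K2/K2E1-p08/g2/MEMO-RaRb-N3-star-currency.md`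
(036989261e32b36a); lane `--kind definition --supports stmt-HodgeConjecture-24833 --as helper` (count-neutral).  Definitions + `Iff.rfl`∕unfolding read-backs only; no instance,
no notation, no axiom, no `sorry`; NOTHING is asserted: (R-a) and (R-b) are `Prop`s WITH PARAMETERS, taken as hypotheses BY NAME by the composition
`Theorems/K2E1ResidualCompactOfBlocks.lean` («socket ⟸ named Props only», the pattern of ★ p855718 ∕ ★ p855969), never proved here.

WHY.  ★ p855862 `residualSpectrumCompact_of_blocks` ∕ `cmResidualSpectrumCompactR_of_blocks` (this seat) reduce ★ `ResidualSpectrumCompact 𝒢 μ 𝔓` to an ORTHOGONAL FAMILY of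
closed `R`-invariant blocks `W j` with `L²_res ≤ closure (⨆ j, W j)`, compactness of `R(f)` on each block and decay of `‖R(f)|W j‖`.  Print's blocks for the quasi-split
`U(3)` are the ISOTYPIC COMPONENTS of the residual spectrum: `L²_res(U(Φ₃)) = (⊕_χ ℂ·(χ∘det)) ⊕ (⊕_ξ ⊗_v π^n(ξ_v))` [Rogawski1990, Thm. 13.3.6 (b) p. 200, §13.9 p. 227],
each occurring with multiplicity one [Thm. 13.3.1].  This leaf TYPES them over ★ without any local-packet token: the block of a GLOBAL CLASS `c : DiscreteClass 𝒢 μ`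
(★ p855297: discrete automorphic representations up to unitary equivalence) is the `c`-isotypic component of `L²_res` (★ `ContRepresentation.isotypicComponent`,
Deitmar–Echterhoff §7.3, the closed span of the irreducible closed subrepresentations of `L²_res` unitarily equivalent to `c`), read in `L²` through ★ `ClosedSubrep.inflate`.
The orthogonality of distinct blocks and `L²_res ≤ closure (⨆ c, resBlock c)` are THEOREMS (★ `isOrtho_isotypicComponent`; discrete decomposability of `L²_res` by
heredity from `L²_disc`), proved in the companion file; what remains NAMED is exactly print's analytic content:
* (R-a) `ResidualBlocksCompact`: `R(f)|resBlock c` compact — ⟸ finite multiplicity `m(c) < ∞` (★ `multiplicity_lt_top_of_mem_discreteSpectrum`, [BorelJacquetCorvallis1979, §4.6];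
  at `N = 3` `m = 1` [Rogawski1990, Thm. 13.3.1]) and admissibility of the irreducible unitary `⊗'_v π_v` [HarishChandra1953; Bernstein1974; FlathCorvallis1979, Thm. 4]
  (`R(f)` compact on an admissible unitary irreducible), or the stronger trace-class row 12′ [Muller1989TraceClass, Thm. 0.1];
* (R-b) `ResidualBlocksDecay`: `‖R(f)|resBlock c‖ → 0` along the cofinite filter of classes — ⟸ Harish-Chandra's finiteness (for each `K_∞ × K_f`-type only finitely many
  residual classes carry it: [HarishChandra1968, Thm. 1] with the finitely many infinitesimal characters of `L²_res`, at `N = 3` read off [Rogawski1990, Thm. 13.3.6 (b)]: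
  finitely many `χ`, `ξ` of given conductor and `∞`-type) and the `L¹`-density of `K`-finite test functions (Peter–Weyl).
The `U(Φ_N)` readings quantify over TEST FUNCTIONS only (★ `UnitaryGroup.IsTestFunction`: restrictions of Garrett's `K`-finite factorizable functions), the weaker and
payable form; all of `C_c` follows by density (★ p855818 `cmResidualSpectrumCompactR_of_testFunctions`, used inside ★ p855862).

CONTENTS.  §1 `resBlock` + read-backs (`resBlock_le_residualSubspace`, `mem_resBlock_iff`).  §2 (R-a) `ResidualBlocksCompact`, (R-b) `ResidualBlocksDecay` (generic ★ adelic
datum `𝒢`, automorphic `μ`, radicals `𝔓`) + `_iff` unfoldings.  §3 `U(Φ_N)` readings `CmResidualBlocksCompactR L N μ`, `CmResidualBlocksDecayR L N μ` (test functions) + unfoldings.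

HONEST LABEL: HC_CM is proved only modulo the 7 printed citations (2 remaining named inputs: hLiu418 = `stmt-HodgeConjecture-24832`, h413 = `stmt-HodgeConjecture-24833`)
until rung 0 closes; this leaf asserts nothing and closes no socket.

## References
* [Rogawski1990] J. Rogawski, *Automorphic Representations of Unitary Groups in Three Variables* (1990), Thm. 13.3.1 p. 199, Thm. 13.3.6 (b) p. 200, §13.9 p. 227.
* [MoeglinWaldspurger1995] C. Mœglin, J.-L. Waldspurger, *Spectral Decomposition and Eisenstein Series* (1995), I.2.18, V.3.13.
* [DeitmarEchterhoff2014] A. Deitmar, S. Echterhoff, *Principles of Harmonic Analysis*, 2nd ed. (2014), §7.3, Cor. 6.1.9.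
* [BorelJacquetCorvallis1979] A. Borel, H. Jacquet, *Automorphic forms and automorphic representations*, PSPM 33.1 (1979), §4.6.
* [HarishChandra1968] Harish-Chandra, *Automorphic Forms on Semisimple Lie Groups*, LNM 62 (1968), Thm. 1.
* [Muller1989TraceClass] W. Müller, *The trace class conjecture in the theory of automorphic forms*, Ann. of Math. 130 (1989), Thm. 0.1.
-/

set_option autoImplicit false
set_option linter.dupNamespace false  -- the mandated namespace repeats the summit's segment (`HodgeConjecture.HodgeConjecture`)

noncomputable section

open Filter Topology MeasureTheory CompactlySupported
open Literature.NumberTheory.Automorphic ContRepresentation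
open Summit.HodgeConjecture.HodgeConjecture.Cruxes.H413.K2E1CuspidalSpectrumUnitary
open Summit.HodgeConjecture.HodgeConjecture.Cruxes.H413.K2E1SpectralTermsDiscreteHalf

namespace Summit.HodgeConjecture.HodgeConjecture.Cruxes.H413.K2E1ResidualBlocks

universe u

/-! ## §1 The residual isotypic block of a discrete class -/

section Generic

variable {K : Type} [Field K] [NumberField K] (𝒢 : AdelicGroupData.{u} K) (μ : Measure 𝒢.automorphicQuotient) [𝒢.IsAutomorphicMeasure μ]
  (𝔓 : 𝒢.ParabolicUnipotentData)

/-- **The residual isotypic block `L²_res[c]` of a discrete class `c`** — the `c`-ISOTYPIC COMPONENT of the residual spectrum `L²_res = L²_disc ⊓ (L²_cusp)ᗮ` (★ `residualSubspace`):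
the closed span of the topologically irreducible closed subrepresentations of `L²_res` unitarily equivalent to (the chosen representative `c.out` of) `c`
(★ `ContRepresentation.isotypicComponent`), read as a closed `R`-invariant subspace of `L²(G(K)A_G ∖ G(𝔸_K), μ)` (★ `ClosedSubrep.inflate`).  Print, quasi-split `U(3)`:
the blocks are the lines `ℂ·(χ∘det)` and the spaces of the residual representations `⊗_v π^n(ξ_v)`, each of multiplicity one.
[cite: Rogawski1990, Thm. 13.3.6 (b) p. 200 and §13.9 p. 227] [cite: DeitmarEchterhoff2014, §7.3] [cite: MoeglinWaldspurger1995, I.2.18] -/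
def resBlock (c : DiscreteClass 𝒢 μ) : ClosedSubrep (𝒢.rightRegular μ) :=
  (residualSubspace 𝒢 μ 𝔓).inflate ((residualSubspace 𝒢 μ 𝔓).toContRep.isotypicComponent c.out.space.toContRep)

/-- Unfolding of `resBlock` (definitional). [cite: DeitmarEchterhoff2014, §7.3] -/
theorem resBlock_def (c : DiscreteClass 𝒢 μ) :
    resBlock 𝒢 μ 𝔓 c = (residualSubspace 𝒢 μ 𝔓).inflate ((residualSubspace 𝒢 μ 𝔓).toContRep.isotypicComponent c.out.space.toContRep) :=
  rfl

/-- Each residual block lies in the residual spectrum. [cite: MoeglinWaldspurger1995, I.2.18] -/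
theorem resBlock_le_residualSubspace (c : DiscreteClass 𝒢 μ) : resBlock 𝒢 μ 𝔓 c ≤ residualSubspace 𝒢 μ 𝔓 :=
  ClosedSubrep.inflate_le _ _

/-- Membership in a residual block: `v ∈ L²_res[c]` iff `v ∈ L²_res` and, as a vector of `L²_res`, `v` lies in the `c`-isotypic component. [cite: DeitmarEchterhoff2014, §7.3] -/
theorem mem_resBlock_iff (c : DiscreteClass 𝒢 μ) {v : 𝒢.L2 μ} :
    v ∈ resBlock 𝒢 μ 𝔓 c ↔ ∃ hv : v ∈ residualSubspace 𝒢 μ 𝔓,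
      (⟨v, hv⟩ : (residualSubspace 𝒢 μ 𝔓).toSubmodule) ∈ (residualSubspace 𝒢 μ 𝔓).toContRep.isotypicComponent c.out.space.toContRep :=
  ClosedSubrep.mem_inflate_iff _ _

end Generic

/-! ## §2 The two named inputs of the block road: (R-a) compactness on each block, (R-b) decay along the classes -/

section NamedInputs

variable {K : Type} [Field K] [NumberField K]

/-- **(R-a) «`R(f)` IS COMPACT ON EACH RESIDUAL BLOCK», BY NAME.**  `ResidualBlocksCompact 𝒢 μ 𝔓`: for the Borel σ-algebra on `G(𝔸_K)`, every Haar measure `η`, every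
`f ∈ C_c(G(𝔸_K), ℂ)` and every discrete class `c`, the block operator `L²_res[c] ∋ w ↦ R(f) w` is compact.  TRUE in print for a connected reductive `G` (each block is a sum of
`m(c) < ∞` copies [BorelJacquetCorvallis1979, §4.6] of an admissible irreducible unitary `⊗'_v π_v`, on which `R(f)` is compact; even trace class for smooth `K`-finite `f`
[Muller1989TraceClass, Thm. 0.1]); for the quasi-split `U(3)` the blocks are lines `ℂ·(χ∘det)` and the `⊗_v π^n(ξ_v)` with `m = 1` [Rogawski1990, Thm. 13.3.1, Thm. 13.3.6 (b)].
AUDIT NOTE (dealer K2E1-plan (g2) 2026-09-04T00:11:41Z): (R-a) silently CONTAINS «every residual isotypic block seen by some `R(f)` has FINITE multiplicity» (a compact `R(f)` on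
`m·π` with `π(f) ≠ 0` forces `m < ∞`); that finiteness is to be PAID FROM THE RESIDUAL DESCRIPTION — row 3 ★ `multiplicity_lt_top_of_mem_discreteSpectrum` [BorelJacquetCorvallis1979, §4.6],
at `N = 3` `m = 1` [Rogawski1990, Thm. 13.3.1, Thm. 13.3.6 (b)] — NEVER from the discrete-spectrum compactness sockets #3 ∕ #12, which would be circular (#12 at `Φ₃` ⟸ 12R3 ⟸ (R-a)).
A `Prop` with parameters, taken as a hypothesis by its consumers; not proved in this file. [cite: Rogawski1990, Thm. 13.3.6 (b) p. 200] [cite: Muller1989TraceClass, Thm. 0.1]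
[cite: BorelJacquetCorvallis1979, §4.6] -/
def ResidualBlocksCompact (𝒢 : AdelicGroupData.{u} K) (μ : Measure 𝒢.automorphicQuotient) [𝒢.IsAutomorphicMeasure μ] (𝔓 : 𝒢.ParabolicUnipotentData) : Prop :=
  ∀ [MeasurableSpace 𝒢.Adelic] [BorelSpace 𝒢.Adelic] (η : Measure 𝒢.Adelic) [η.IsHaarMeasure] (f : C_c(𝒢.Adelic, ℂ)) (c : DiscreteClass 𝒢 μ),
    IsCompactOperator fun w : (resBlock 𝒢 μ 𝔓 c).toSubmodule =>
      (𝒢.rightRegular μ).integratedOperator (𝒢.isUnitary_rightRegular μ) (𝒢.isStronglyContinuous_rightRegular_holds μ) η f (w : 𝒢.L2 μ)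

/-- Unfolding of (R-a). [cite: Rogawski1990, Thm. 13.3.6 (b) p. 200] -/
theorem residualBlocksCompact_iff (𝒢 : AdelicGroupData.{u} K) (μ : Measure 𝒢.automorphicQuotient) [𝒢.IsAutomorphicMeasure μ] (𝔓 : 𝒢.ParabolicUnipotentData) :
    ResidualBlocksCompact 𝒢 μ 𝔓 ↔
      ∀ [MeasurableSpace 𝒢.Adelic] [BorelSpace 𝒢.Adelic] (η : Measure 𝒢.Adelic) [η.IsHaarMeasure] (f : C_c(𝒢.Adelic, ℂ)) (c : DiscreteClass 𝒢 μ),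
        IsCompactOperator fun w : (resBlock 𝒢 μ 𝔓 c).toSubmodule =>
          (𝒢.rightRegular μ).integratedOperator (𝒢.isUnitary_rightRegular μ) (𝒢.isStronglyContinuous_rightRegular_holds μ) η f (w : 𝒢.L2 μ) :=
  Iff.rfl

/-- **(R-b) «THE BLOCK NORMS OF `R(f)` DECAY ALONG THE CLASSES», BY NAME.**  `ResidualBlocksDecay 𝒢 μ 𝔓`: for the Borel σ-algebra, every Haar `η` and every `f ∈ C_c(G(𝔸_K), ℂ)`,
`‖R(f) ∘ ι_{L²_res[c]}‖ → 0` along the cofinite filter of discrete classes `c`.  TRUE in print: for `K_∞ × K_f`-finite `f′` the block operator `R(f′)|L²_res[c]` VANISHES unless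
`c` carries one of the finitely many `K`-types of `f′`, which only finitely many residual classes do (Harish-Chandra's finiteness [HarishChandra1968, Thm. 1] together with the
finitely many infinitesimal characters of `L²_res`; for the quasi-split `U(3)`: finitely many `χ∘det` and `⊗_v π^n(ξ_v)` of given conductor and `∞`-type
[Rogawski1990, Thm. 13.3.6 (b), §13.9]), and `‖R(f) − R(f′)‖ ≤ ‖f − f′‖₁` with `K`-finite `f′` `L¹`-dense (Peter–Weyl).  This is the honest replacement of «`(L²_res)^{K_f}`
finite-dimensional», which is FALSE (the lines `ℂ·(χ∘det)` of all `∞`-types at a fixed finite level).  A `Prop` with parameters, taken as a hypothesis by its consumers;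
not proved in this file. [cite: Rogawski1990, Thm. 13.3.6 (b) p. 200 and §13.9 p. 227] [cite: HarishChandra1968, Thm. 1] [cite: MoeglinWaldspurger1995, V.3.13] -/
def ResidualBlocksDecay (𝒢 : AdelicGroupData.{u} K) (μ : Measure 𝒢.automorphicQuotient) [𝒢.IsAutomorphicMeasure μ] (𝔓 : 𝒢.ParabolicUnipotentData) : Prop :=
  ∀ [MeasurableSpace 𝒢.Adelic] [BorelSpace 𝒢.Adelic] (η : Measure 𝒢.Adelic) [η.IsHaarMeasure] (f : C_c(𝒢.Adelic, ℂ)),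
    Tendsto (fun c : DiscreteClass 𝒢 μ =>
      ‖((𝒢.rightRegular μ).integratedOperator (𝒢.isUnitary_rightRegular μ) (𝒢.isStronglyContinuous_rightRegular_holds μ) η f).comp
        (resBlock 𝒢 μ 𝔓 c).toSubmodule.subtypeL‖) cofinite (𝓝 0)

/-- Unfolding of (R-b). [cite: Rogawski1990, Thm. 13.3.6 (b) p. 200 and §13.9 p. 227] -/
theorem residualBlocksDecay_iff (𝒢 : AdelicGroupData.{u} K) (μ : Measure 𝒢.automorphicQuotient) [𝒢.IsAutomorphicMeasure μ] (𝔓 : 𝒢.ParabolicUnipotentData) :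
    ResidualBlocksDecay 𝒢 μ 𝔓 ↔
      ∀ [MeasurableSpace 𝒢.Adelic] [BorelSpace 𝒢.Adelic] (η : Measure 𝒢.Adelic) [η.IsHaarMeasure] (f : C_c(𝒢.Adelic, ℂ)),
        Tendsto (fun c : DiscreteClass 𝒢 μ =>
          ‖((𝒢.rightRegular μ).integratedOperator (𝒢.isUnitary_rightRegular μ) (𝒢.isStronglyContinuous_rightRegular_holds μ) η f).comp
            (resBlock 𝒢 μ 𝔓 c).toSubmodule.subtypeL‖) cofinite (𝓝 0) :=
  Iff.rfl

end NamedInputs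

/-! ## §3 The `U(Φ_N)` readings, on TEST FUNCTIONS (sockets `sig_K2E1ResidualCompactU2` ∕ `sig_K2E1ResidualCompactU3R` through the companion composition) -/

section Unitary

open NumberField Literature.NumberTheory.Automorphic.UnitaryGroup

/-- **(R-a) FOR `U(Φ_N)` ON TEST FUNCTIONS, BY NAME.**  `CmResidualBlocksCompactR L N μ`: for every Haar `η` on `U(Φ_N)(𝔸_{L⁺})` and every TEST FUNCTION `φ`
(★ `UnitaryGroup.IsTestFunction L N Φ_N φ`), `R(φ)` is compact on each residual block `L²_res(U(Φ_N))[c]` along the printed radicals ★ `cmParabolicDataR L N`.  At `N = 3`: the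
blocks are `ℂ·(χ∘det)` and `⊗_v π^n(ξ_v)` (`m = 1`), admissible, so `R(φ)` has finite rank on each; the finite multiplicity hidden in (R-a) is paid from this DESCRIPTION, never from
sockets #3 ∕ #12 (see the AUDIT NOTE at `ResidualBlocksCompact`). A `Prop` with parameters; not proved here.
[cite: Rogawski1990, Thm. 13.3.1 p. 199 and Thm. 13.3.6 (b) p. 200] [cite: Muller1989TraceClass, Thm. 0.1] -/
def CmResidualBlocksCompactR (L : Type) [Field L] [NumberField L] [IsCMField L] (N : ℕ)
    (μ : Measure (cmDatum L N (Matrix.of fun i j : Fin N => if i.val + j.val + 1 = N then (1 : L) else 0)).automorphicQuotient)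
    [(cmDatum L N (Matrix.of fun i j : Fin N => if i.val + j.val + 1 = N then (1 : L) else 0)).IsAutomorphicMeasure μ] : Prop :=
  ∀ [MeasurableSpace (cmDatum L N (Matrix.of fun i j : Fin N => if i.val + j.val + 1 = N then (1 : L) else 0)).Adelic]
    [BorelSpace (cmDatum L N (Matrix.of fun i j : Fin N => if i.val + j.val + 1 = N then (1 : L) else 0)).Adelic]
    (η : Measure (cmDatum L N (Matrix.of fun i j : Fin N => if i.val + j.val + 1 = N then (1 : L) else 0)).Adelic) [η.IsHaarMeasure]
    (φ : C_c((cmDatum L N (Matrix.of fun i j : Fin N => if i.val + j.val + 1 = N then (1 : L) else 0)).Adelic, ℂ)),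
    IsTestFunction L N (Matrix.of fun i j : Fin N => if i.val + j.val + 1 = N then (1 : L) else 0) φ →
    ∀ c : DiscreteClass (cmDatum L N (Matrix.of fun i j : Fin N => if i.val + j.val + 1 = N then (1 : L) else 0)) μ,
      IsCompactOperator fun w : (resBlock (cmDatum L N (Matrix.of fun i j : Fin N => if i.val + j.val + 1 = N then (1 : L) else 0)) μ (cmParabolicDataR L N) c).toSubmodule =>
        ((cmDatum L N (Matrix.of fun i j : Fin N => if i.val + j.val + 1 = N then (1 : L) else 0)).rightRegular μ).integratedOperator
          ((cmDatum L N (Matrix.of fun i j : Fin N => if i.val + j.val + 1 = N then (1 : L) else 0)).isUnitary_rightRegular μ)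
          ((cmDatum L N (Matrix.of fun i j : Fin N => if i.val + j.val + 1 = N then (1 : L) else 0)).isStronglyContinuous_rightRegular_holds μ) η φ
          (w : (cmDatum L N (Matrix.of fun i j : Fin N => if i.val + j.val + 1 = N then (1 : L) else 0)).L2 μ)

/-- **(R-b) FOR `U(Φ_N)` ON TEST FUNCTIONS, BY NAME.**  `CmResidualBlocksDecayR L N μ`: for every Haar `η` and every TEST FUNCTION `φ`, `‖R(φ) ∘ ι_{L²_res(U(Φ_N))[c]}‖ → 0`
cofinitely in the class `c`.  At `N = 3`, for `K`-finite `φ` the block operators even VANISH off the finitely many residual classes `χ∘det`, `⊗_v π^n(ξ_v)` of the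
conductor and `∞`-types of `φ` (Harish-Chandra finiteness read off Rogawski's description of `L²_res`). A `Prop` with parameters; not proved here.
[cite: Rogawski1990, Thm. 13.3.6 (b) p. 200 and §13.9 p. 227] [cite: HarishChandra1968, Thm. 1] -/
def CmResidualBlocksDecayR (L : Type) [Field L] [NumberField L] [IsCMField L] (N : ℕ)
    (μ : Measure (cmDatum L N (Matrix.of fun i j : Fin N => if i.val + j.val + 1 = N then (1 : L) else 0)).automorphicQuotient)
    [(cmDatum L N (Matrix.of fun i j : Fin N => if i.val + j.val + 1 = N then (1 : L) else 0)).IsAutomorphicMeasure μ] : Prop :=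
  ∀ [MeasurableSpace (cmDatum L N (Matrix.of fun i j : Fin N => if i.val + j.val + 1 = N then (1 : L) else 0)).Adelic]
    [BorelSpace (cmDatum L N (Matrix.of fun i j : Fin N => if i.val + j.val + 1 = N then (1 : L) else 0)).Adelic]
    (η : Measure (cmDatum L N (Matrix.of fun i j : Fin N => if i.val + j.val + 1 = N then (1 : L) else 0)).Adelic) [η.IsHaarMeasure]
    (φ : C_c((cmDatum L N (Matrix.of fun i j : Fin N => if i.val + j.val + 1 = N then (1 : L) else 0)).Adelic, ℂ)),
    IsTestFunction L N (Matrix.of fun i j : Fin N => if i.val + j.val + 1 = N then (1 : L) else 0) φ →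
    Tendsto (fun c : DiscreteClass (cmDatum L N (Matrix.of fun i j : Fin N => if i.val + j.val + 1 = N then (1 : L) else 0)) μ =>
      ‖(((cmDatum L N (Matrix.of fun i j : Fin N => if i.val + j.val + 1 = N then (1 : L) else 0)).rightRegular μ).integratedOperator
          ((cmDatum L N (Matrix.of fun i j : Fin N => if i.val + j.val + 1 = N then (1 : L) else 0)).isUnitary_rightRegular μ)
          ((cmDatum L N (Matrix.of fun i j : Fin N => if i.val + j.val + 1 = N then (1 : L) else 0)).isStronglyContinuous_rightRegular_holds μ) η φ).comp
        (resBlock (cmDatum L N (Matrix.of fun i j : Fin N => if i.val + j.val + 1 = N then (1 : L) else 0)) μ (cmParabolicDataR L N) c).toSubmodule.subtypeL‖)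
      cofinite (𝓝 0)

/-- **The generic (R-a) at the `U(Φ_N)` instance implies the test-function reading** (restriction of the quantifier). [cite: Rogawski1990, Thm. 13.3.6 (b) p. 200] -/
theorem cmResidualBlocksCompactR_of_residualBlocksCompact (L : Type) [Field L] [NumberField L] [IsCMField L] (N : ℕ)
    (μ : Measure (cmDatum L N (Matrix.of fun i j : Fin N => if i.val + j.val + 1 = N then (1 : L) else 0)).automorphicQuotient)
    [(cmDatum L N (Matrix.of fun i j : Fin N => if i.val + j.val + 1 = N then (1 : L) else 0)).IsAutomorphicMeasure μ]
    (h : ResidualBlocksCompact (cmDatum L N (Matrix.of fun i j : Fin N => if i.val + j.val + 1 = N then (1 : L) else 0)) μ (cmParabolicDataR L N)) :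
    CmResidualBlocksCompactR L N μ :=
  fun η _ φ _ c => h η φ c

/-- **The generic (R-b) at the `U(Φ_N)` instance implies the test-function reading** (restriction of the quantifier). [cite: Rogawski1990, Thm. 13.3.6 (b) p. 200] -/
theorem cmResidualBlocksDecayR_of_residualBlocksDecay (L : Type) [Field L] [NumberField L] [IsCMField L] (N : ℕ)
    (μ : Measure (cmDatum L N (Matrix.of fun i j : Fin N => if i.val + j.val + 1 = N then (1 : L) else 0)).automorphicQuotient)
    [(cmDatum L N (Matrix.of fun i j : Fin N => if i.val + j.val + 1 = N then (1 : L) else 0)).IsAutomorphicMeasure μ]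
    (h : ResidualBlocksDecay (cmDatum L N (Matrix.of fun i j : Fin N => if i.val + j.val + 1 = N then (1 : L) else 0)) μ (cmParabolicDataR L N)) :
    CmResidualBlocksDecayR L N μ :=
  fun η _ φ _ => h η φ

end Unitary

end Summit.HodgeConjecture.HodgeConjecture.Cruxes.H413.K2E1ResidualBlocks

end
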